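import Summits.BirchSwinnertonDyer.BirchSwinnertonDyer.Theorems.QuadraticBranchSignedControlPlusEtaLowerInclusionValuationSqueezeDivisible
import HarnessLib

/-!
# Route `QuadraticBranchSignedControl` (rung K8, cell `bsd-potss`), crux `PlusEtaLowerInclusion`
# (item stmt-BirchSwinnertonDyer-19601): the leading coefficient of `Char X⁺(V/K_∞)^η` is the
# TORSION PART times the HEIGHT INDEX — the crux at a tower-onto pair of any rank from two displayed
# exponents

WHAT. Seventh file of the valuation-squeeze road (p499967, p500695, p502879, p503867, p505261, p507131).
p502879 identified the `r`-th coefficient of a characteristic power series `ξ_η` of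
`X_η = X⁺(V/K₀ℚ_∞)^η` at a tower-onto pair with `#coker(φ : X_η[T] → X_η/TX_η)` up to a unit, and
p505261 proved `#(X_η/TX_η)_tors ∣ #coker φ`. THIS FILE proves the EXACT splitting

  `#coker φ = #(X_η/TX_η)_tors · #( X_η/TX_η ⁄ ((X_η/TX_η)_tors + φ(X_η[T])) )`,

the second factor being the HEIGHT INDEX — the index of the image of `X_η[T]` in the torsion-free
quotient of the `Γ`-coinvariants (for `X ≃ Λ/T ⊕ Λ/(T − a)` it is `#ℤ_p/a`: the `p`-adic valuation of the
Bockstein = height pairing on the free part), so that the crux at the pair follows from TWO displayed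
exponents `a`, `b` with the analytic certificate at `v = a + b`: `p^a ∣ #(S^Γ/B)` for some divisible
finite-index `B ≤ S^Γ` (the Tamagawa / Ш part, p507131) and `p^b ∣` the height index (§3). WHY THIS
FORM: on the rank-one tower-onto census rows of 19601 the torsion part is certified by the Tamagawa road
(Poitou–Tate count) and the REMAINING content of the crux at the residue row `69150v1` is exactly one
unit of height index (`b = 1`; seat k8eta-c1 g10's η-height instrument reads the generator's η-plus
height there with valuation one above its thirteen two-Tamagawa-prime siblings, kit j302973). None of
the identifications «height index = valuation of the η-plus `p`-adic height» is proved here (it is the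
η-analogue of Castella's leading-term formula, arXiv:2502.19618 Thm. 1, NOT in print at `η`).

Chain: §1 (pure `Λ`-algebra) for a `Λ`-module `M` in which every FINITE `Λ`-submodule vanishes and
`ker φ_M = 0`: the `ℤ`-torsion of `M/TM` meets `φ_M(M[T])` trivially (a torsion class in the image
lifts to a torsion element of the torsion-free `M[T]`, p505261 §1), hence by the third isomorphism
theorem `#(M/TM ⁄ φM[T]) = #(M/TM)_tors · #(M/TM ⁄ (tors ⊔ φM[T]))`; §2 the `η`-datum at a tower-onto
pair (`ker φ = 0` and no finite submodules: p502879 + Kitajima–Otsuki); §3 the roads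
`quadraticBranchPlusEtaLowerInclusionAt_of_namedFacts_of_certV_of_divisibleIndexDvd_of_heightIndexDvd` (torsion
part as the index of a divisible subgroup of `S^Γ`, p507131's currency) and `…_of_torsionDvd_of_heightIndexDvd`
(torsion part as `p^a ∣ #(X_η/TX_η)_tors`, p505261's currency). The torsion slot is filled by the
TAMAGAWA ROAD (p515151 §1, Poitou–Tate) in the companion record file `…PlusEtaR1HeightRows01`: (E⁺_η) ∧ (C1⁺_η)
at the pair from `a + r ≤ ∑_T ord_p c_ℓ(W)` and `p^b ∣` height index — the shape the residue row `69150v1`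
needs with `a = b = 1`.

HONEST FRAMING (cell `bsd-potss`, run/shared/lean/pub/bsd-potss/; FULL-BSD rank ≤ 1 programme, HUMAN
RULING D-0036/D-0074): TOOL THEOREMS ONLY, CONDITIONAL on the named Literature facts (Kobayashi 2003
Thm. 1.2/1.3/2.2η/4.1η, Kitajima–Otsuki 2018 Thm. 1.3 at `η`; hypothesis position), on the tower-onto
hypothesis, the `V`-certificate and the analytic certificate (NOT supplied here for any pair), and in §3
on the per-pair torsion and height-index inputs (the latter OPEN on every rank-one row). The crux 19601 is
OPEN class-wide and NOT closed; nothing is booked; `BSD(W, p)` is claimed for no pair. No definition,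
no named fact, no `sorry`, axioms standard. Seat `bsd-potss-k8eta-c1` (prover), g10;
`--supports stmt-BirchSwinnertonDyer-19601`.

References: [Kobayashi2003] Thm. 2.2, §4 + Thm. 4.1; [KitajimaOtsuki2018] Thm. 1.3;
[CoatesSchneiderSujatha2003] §3 (30)–(31); [GreenbergLNM1716] §3–4; [Castella2025] = arXiv:2502.19618
Thm. 1, §2.3 (trivial branch; the shape of the formula whose η-analogue motivates the height index).
-/

set_option autoImplicit false
set_option linter.dupNamespace false
noncomputable section

open scoped Classical
open CongruenceSubgroup Field WeierstrassCurve
open Literature.NumberTheory.EllipticCurves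
open Literature.NumberTheory.EllipticCurves.ModularForms
open Literature.NumberTheory.GaloisRepresentations
open Summit.BirchSwinnertonDyer.Rank1Residual.Additive

namespace Summit.BirchSwinnertonDyer.BirchSwinnertonDyer.Theorems

/-! ## §1 Torsion part × height index (pure `Λ`-algebra) -/

section Algebra

variable {p : ℕ} [Fact p.Prime] {M : Type} [AddCommGroup M] [Module (IwasawaAlgebra p) M]

/-- **The `ℤ`-torsion of `M/TM` meets `φ_M(M[T])` trivially** when the finite `Λ`-submodules of `M`
vanish and `ker φ_M = 0`: if `x = φ_M(y)` has finite order `n` then `n • y ∈ ker φ_M = 0`, so `y` is a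
torsion element of the `ℤ`-torsion-free `M[T]` (p505261 §1), hence `y = 0` and `x = 0`.
[cite: CoatesSchneiderSujatha2003, §3 (30) (the map φ)] -/
theorem torsion_inf_range_bockstein_eq_bot [Module.Finite (IwasawaAlgebra p) M]
    (hnf : ∀ N : Submodule (IwasawaAlgebra p) M, Finite N → N = ⊥)
    (hker : LinearMap.ker (IwasawaAlgebra.bockstein p M) = ⊥) :
    Submodule.torsion ℤ (IwasawaAlgebra.coinvariants p M) ⊓
        (LinearMap.range (IwasawaAlgebra.bockstein p M)).restrictScalars ℤ = ⊥ := by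
  rw [Submodule.eq_bot_iff]
  rintro x ⟨hxT, hxI⟩
  have hxT' : x ∈ AddCommGroup.torsion (IwasawaAlgebra.coinvariants p M) := by
    rw [← Submodule.torsion_int]; exact hxT
  obtain ⟨n, hn, hnx⟩ := ((AddCommGroup.mem_torsion _).mp hxT').exists_nsmul_eq_zero
  obtain ⟨y, hy⟩ := LinearMap.mem_range.mp (Submodule.restrictScalars_mem _ _ _ |>.mp hxI)
  have hny : n • y ∈ LinearMap.ker (IwasawaAlgebra.bockstein p M) := by
    rw [LinearMap.mem_ker, map_nsmul, hy, hnx]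
  rw [hker, Submodule.mem_bot] at hny
  have hy0 : (y : M) = 0 :=
    eq_zero_of_X_smul_eq_zero_of_nsmul_eq_zero hnf
      ((IwasawaAlgebra.mem_invariants_iff p M _).mp y.2) hn.ne'
      (by rw [← AddSubmonoidClass.coe_nsmul, hny, ZeroMemClass.coe_zero])
  rw [← hy, show y = 0 from Subtype.ext hy0, map_zero]

/-- **`#coker φ_M = #(M/TM)_tors · #(M/TM ⁄ (tors ⊔ φ_M(M[T])))`** (torsion part × HEIGHT INDEX) when
the finite `Λ`-submodules of `M` vanish and `ker φ_M = 0`: the third isomorphism theorem for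
`φ_M(M[T]) ≤ tors ⊔ φ_M(M[T])`, with `(tors ⊔ φM[T])/φM[T] ≃ tors` because `tors ⊓ φM[T] = 0`.
(`Nat.card`, valid without finiteness: both sides vanish together.) For `M = Λ/T ⊕ Λ/(T − a)`,
`a ∈ pℤ_p ∖ 0`: torsion part `1`, height index `#(ℤ_p/a)`. [cite: CoatesSchneiderSujatha2003, §3 (30)–(31)]
[cite: GreenbergLNM1716, §4 (leading term and the height pairing)] -/
theorem natCard_coker_bockstein_eq_torsion_mul_heightIndex [Module.Finite (IwasawaAlgebra p) M]
    (hnf : ∀ N : Submodule (IwasawaAlgebra p) M, Finite N → N = ⊥)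
    (hker : LinearMap.ker (IwasawaAlgebra.bockstein p M) = ⊥) :
    Nat.card (IwasawaAlgebra.coinvariants p M ⧸ LinearMap.range (IwasawaAlgebra.bockstein p M)) =
      Nat.card (AddCommGroup.torsion (IwasawaAlgebra.coinvariants p M)) *
        Nat.card (IwasawaAlgebra.coinvariants p M ⧸
          (Submodule.torsion ℤ (IwasawaAlgebra.coinvariants p M) ⊔
            (LinearMap.range (IwasawaAlgebra.bockstein p M)).restrictScalars ℤ)) := by
  set C := IwasawaAlgebra.coinvariants p M
  set I : Submodule ℤ C := (LinearMap.range (IwasawaAlgebra.bockstein p M)).restrictScalars ℤ with hI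
  set Tz : Submodule ℤ C := Submodule.torsion ℤ C with hTz
  -- (a) the quotient by the `Λ`-submodule is the quotient by the `ℤ`-submodule
  have ha : Nat.card (C ⧸ LinearMap.range (IwasawaAlgebra.bockstein p M)) = Nat.card (C ⧸ I) :=
    Nat.card_congr (Submodule.Quotient.restrictScalarsEquiv ℤ
      (LinearMap.range (IwasawaAlgebra.bockstein p M))).toEquiv.symm
  -- (b) third isomorphism theorem
  have hb := Submodule.card_quotient_mul_card_quotient (Tz ⊔ I) I le_sup_right
  -- (c) `(Tz ⊔ I)/I = image of Tz`
  have hc : (Tz ⊔ I).map I.mkQ = Tz.map I.mkQ := by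
    rw [Submodule.map_sup, Submodule.mkQ_map_self, sup_bot_eq]
  -- (d) `Tz → C/I` is injective (`Tz ⊓ I = 0`)
  have hinf : Tz ⊓ I = ⊥ := torsion_inf_range_bockstein_eq_bot hnf hker
  have hinj : Function.Injective (I.mkQ.domRestrict Tz) := by
    rw [← LinearMap.ker_eq_bot, Submodule.eq_bot_iff]
    intro x hx
    rw [LinearMap.mem_ker, LinearMap.domRestrict_apply, Submodule.mkQ_apply,
      Submodule.Quotient.mk_eq_zero] at hx
    have : (x : C) ∈ Tz ⊓ I := ⟨x.2, hx⟩
    rw [hinf, Submodule.mem_bot] at this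
    exact Subtype.ext this
  have hd : Nat.card (Tz.map I.mkQ) = Nat.card Tz := by
    have e := (LinearEquiv.ofInjective _ hinj).trans
      (LinearEquiv.ofEq _ _ (LinearMap.range_domRestrict Tz I.mkQ))
    exact (Nat.card_congr e.toEquiv).symm
  -- (e) `Tz` and `AddCommGroup.torsion C` have the same carrier
  have he : Nat.card Tz = Nat.card (AddCommGroup.torsion C) := by
    rw [← Submodule.torsion_int]; rfl
  rw [ha, ← hb, hc, hd, he]

end Algebra

/-! ## §2 The `η`-datum at a tower-onto pair -/

section Pair

variable {V : WeierstrassCurve ℚ} [V.IsElliptic] [V.IsGloballyMinimal] {p : ℕ} [Fact p.Prime]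

/-- **`#coker φ_{X_η}` = torsion part × height index at a tower-onto pair.** GRANTED Kobayashi's
Thm. 1.2 / 1.3 / 2.2(η) / 4.1(η) and Kitajima–Otsuki's Thm. 1.3 at `η` (NAMED facts), on a good
`a_p = 0` pair with `p ≥ 5`, `ρ_{V,p^m}` onto, the `V`-certificate and `coeff_r L_p⁺(V,η,T) ≠ 0`: for
every `η`-datum `D`,
`#coker(φ : D.X[T] → D.X/T·D.X) = #(D.X/T·D.X)_tors · #(D.X/T·D.X ⁄ (tors ⊔ φ(D.X[T])))`
(§1; `ker φ = 0` and no finite submodules by p502879 / p505261 + Kitajima–Otsuki). With p502879 the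
`r`-th coefficient of `Char(D.X)` is, up to a unit, this product. CONDITIONAL; asserts nothing on either factor.
[cite: Kobayashi2003, Thm. 2.2 (p. 5), Thm. 4.1 and §4 (p. 8)] [cite: KitajimaOtsuki2018, Thm. 1.3]
[cite: CoatesSchneiderSujatha2003, §3 (30)–(31)] -/
theorem natCard_coker_bockstein_eta_eq_torsion_mul_heightIndex
    (h12 : Kobayashi2003.thm12_signedSelmerDual_finite_torsion)
    (h13 : Kobayashi2003.thm41_signedCharIdeal_divisibility)
    (h22 : Kobayashi2003.thm22_etaSignedSelmerDual_finite_torsion)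
    (h41 : Kobayashi2003.thm41_plusEtaCharIdeal_dvd)
    (hKO : KitajimaOtsuki2018.mainThm13_etaSignedSelmerDual_noFiniteSubmodule)
    (hp5 : 5 ≤ p) (hgood : V.HasGoodReductionAtPrime p) (hap : V.frobeniusTrace p = 0)
    (hsurj : ∀ m : ℕ, V.HasSurjectiveModNGaloisRep (p ^ m : ℕ))
    (hcertV : ∀ {N : ℕ} [NeZero N] (f : CuspForm (Gamma0 N) 2), IsNewformOf V f →
      ∃ L : IwasawaAlgebra p, Kobayashi2003.IsSignedPAdicLFunction f p 1 L ∧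
        IsUnit (PowerSeries.coeff V.mordellWeilRank L))
    {N : ℕ} [NeZero N] {f : CuspForm (Gamma0 N) 2} (hf : IsNewformOf V f) (ϖ : ℚ)
    (hϖ : if Even (p / 2) then (ϖ : ℝ) * V.realPeriodRat = plusPeriod f
      else (ϖ : ℝ) * V.imaginaryPeriodRat = minusPeriod f)
    (Lη : IwasawaAlgebra p) (hL : IsQuadraticBranchPlusLFunction f p ϖ Lη)
    (hne : PowerSeries.coeff (V.quadraticTwist ((-1) ^ (p / 2) * p)).mordellWeilRank Lη ≠ 0)
    (K₀ : Type) [Field K₀] [NumberField K₀] [IsCyclotomicExtension {p} ℚ K₀]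
    [(galRange (K := ℚ) K₀).Normal] (ηq : absoluteGaloisGroup ℚ →* ℤˣ)
    (hηK : ∀ σ ∈ galRange (K := ℚ) K₀, ηq σ = 1) (hη1 : ηq ≠ 1)
    (κ : ZpExtension ℚ p) (γ : absoluteGaloisGroup ℚ) (hκ : κ.IsCyclotomic) (hγ : κ.IsTopGenerator γ)
    (hγK : γ ∈ galRange (K := ℚ) K₀) (hγc : IsCyclotomicVariable p γ)
    (D : EtaSignedSelmerDualData V κ K₀ ℚ_[p] ηq γ 1) :
    Nat.card (IwasawaAlgebra.coinvariants p D.X ⧸ LinearMap.range (IwasawaAlgebra.bockstein p D.X)) =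
      Nat.card (AddCommGroup.torsion (IwasawaAlgebra.coinvariants p D.X)) *
        Nat.card (IwasawaAlgebra.coinvariants p D.X ⧸
          (Submodule.torsion ℤ (IwasawaAlgebra.coinvariants p D.X) ⊔
            (LinearMap.range (IwasawaAlgebra.bockstein p D.X)).restrictScalars ℤ)) := by
  have hp2 : p ≠ 2 := by omega
  obtain ⟨hfin, htor⟩ :=
    EtaSignedSelmerDualData.finite_isTorsion_of_thm22 h22 hηK hp2 hgood hap hκ hγ hγK D
  haveI : Module.Finite (IwasawaAlgebra p) D.X := hfin
  have hnf : ∀ N : Submodule (IwasawaAlgebra p) D.X, Finite N → N = ⊥ :=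
    hKO p K₀ ηq hηK V hp2 hgood hap κ γ hκ hγ hγK 1 D.toLiterature hfin htor
  obtain ⟨hker, -⟩ := ker_bockstein_eq_bot_and_natCard_torsion_coinvariants_dvd h12 h13 h22 h41 hKO
    hp5 hgood hap hsurj (fun f hf => hcertV f hf) hf ϖ hϖ Lη hL hne K₀ ηq hηK hη1 κ γ hκ hγ hγK hγc D
  exact natCard_coker_bockstein_eq_torsion_mul_heightIndex hnf hker

/-! ## §3 The road: torsion exponent `a` + height-index exponent `b` -/

/-- **(E⁺_η) AT A TOWER-ONTO PAIR OF ANY RANK from the COTORSION of `Sel⁺(V/K_∞)^{η,Γ}` AND the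
HEIGHT INDEX.** GRANTED Kobayashi's Thm. 1.2 / 1.3 / 2.2(η) / 4.1(η) and Kitajima–Otsuki's Thm. 1.3
at `η` (NAMED facts), `p ≥ 5`, `V` good with `a_p = 0`, `ρ_{V,p^m}` onto, the `V`-certificate, TWO
integers `a`, `b` with the ANALYTIC certificate `p^{a+b+1} ∤ coeff_r L_p⁺(V,η,T)` (`r = rank V^{(p*)}(ℚ)`)
and the inputs, for every admissible `(K₀, η, κ, γ)`: (torsion part) SOME divisible subgroup `B` of
`S^Γ` (`S = Sel⁺(V/K₀ℚ_∞)^η`) of finite index with `p^a ∣ #(S^Γ/B)`, and (height index) for every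
`η`-datum `D`, `p^b ∣ #(D.X/T·D.X ⁄ (tors ⊔ φ(D.X[T])))`. Then (E⁺_η)(V, p). `b = 0` is p507131's road;
on the rank-one rows `a` is the Tamagawa / Ш exponent of the bottom-layer control and `b` the `p`-adic
valuation of the Bockstein (height) pairing on the free part — for the residue row `69150v1` of crux 19601
the needed input is `a = 1` (certified, Poitou–Tate count) and `b = 1` (OPEN). CONDITIONAL; closes nothing.
[cite: Kobayashi2003, Thm. 2.2 (p. 5), Thm. 4.1 and §4 (p. 8)] [cite: KitajimaOtsuki2018, Thm. 1.3]
[cite: GreenbergLNM1716, §1 p. 60 and §3–4] -/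
theorem quadraticBranchPlusEtaLowerInclusionAt_of_namedFacts_of_certV_of_divisibleIndexDvd_of_heightIndexDvd
    (h12 : Kobayashi2003.thm12_signedSelmerDual_finite_torsion)
    (h13 : Kobayashi2003.thm41_signedCharIdeal_divisibility)
    (h22 : Kobayashi2003.thm22_etaSignedSelmerDual_finite_torsion)
    (h41 : Kobayashi2003.thm41_plusEtaCharIdeal_dvd)
    (hKO : KitajimaOtsuki2018.mainThm13_etaSignedSelmerDual_noFiniteSubmodule)
    (hp5 : 5 ≤ p) (hgood : V.HasGoodReductionAtPrime p) (hap : V.frobeniusTrace p = 0)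
    (hsurj : ∀ m : ℕ, V.HasSurjectiveModNGaloisRep (p ^ m : ℕ))
    (hcertV : ∀ {N : ℕ} [NeZero N] (f : CuspForm (Gamma0 N) 2), IsNewformOf V f →
      ∃ L : IwasawaAlgebra p, Kobayashi2003.IsSignedPAdicLFunction f p 1 L ∧
        IsUnit (PowerSeries.coeff V.mordellWeilRank L))
    (a b : ℕ)
    (han : ∀ {N : ℕ} [NeZero N] {f : CuspForm (Gamma0 N) 2}, IsNewformOf V f →
      ∀ (ϖ : ℚ), (if Even (p / 2) then (ϖ : ℝ) * V.realPeriodRat = plusPeriod f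
          else (ϖ : ℝ) * V.imaginaryPeriodRat = minusPeriod f) →
      ∀ (Lη : IwasawaAlgebra p), IsQuadraticBranchPlusLFunction f p ϖ Lη →
        ¬ (p : ℤ_[p]) ^ (a + b + 1) ∣
          PowerSeries.coeff (V.quadraticTwist ((-1) ^ (p / 2) * p)).mordellWeilRank Lη)
    (hcot : ∀ (K₀ : Type) [Field K₀] [NumberField K₀] [IsCyclotomicExtension {p} ℚ K₀]
      [(galRange (K := ℚ) K₀).Normal] (ηq : absoluteGaloisGroup ℚ →* ℤˣ),
      (∀ σ ∈ galRange (K := ℚ) K₀, ηq σ = 1) → ηq ≠ 1 →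
      ∀ (κ : ZpExtension ℚ p) (γ : absoluteGaloisGroup ℚ),
        κ.IsCyclotomic → κ.IsTopGenerator γ → γ ∈ galRange (K := ℚ) K₀ → IsCyclotomicVariable p γ →
      ∃ B : AddSubgroup
          (IwasawaDual.endInvariants (conjTowerSignedSelmerInftyEta V κ K₀ ℚ_[p] ηq 1 γ - 1)),
        (∀ n : ℕ, n ≠ 0 → ∀ x ∈ B, ∃ x' ∈ B, n • x' = x) ∧
        Finite (IwasawaDual.endInvariants (conjTowerSignedSelmerInftyEta V κ K₀ ℚ_[p] ηq 1 γ - 1) ⧸ B) ∧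
        p ^ a ∣ Nat.card
          (IwasawaDual.endInvariants (conjTowerSignedSelmerInftyEta V κ K₀ ℚ_[p] ηq 1 γ - 1) ⧸ B))
    (hht : ∀ (K₀ : Type) [Field K₀] [NumberField K₀] [IsCyclotomicExtension {p} ℚ K₀]
      [(galRange (K := ℚ) K₀).Normal] (ηq : absoluteGaloisGroup ℚ →* ℤˣ),
      (∀ σ ∈ galRange (K := ℚ) K₀, ηq σ = 1) → ηq ≠ 1 →
      ∀ (κ : ZpExtension ℚ p) (γ : absoluteGaloisGroup ℚ),
        κ.IsCyclotomic → κ.IsTopGenerator γ → γ ∈ galRange (K := ℚ) K₀ → IsCyclotomicVariable p γ →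
      ∀ (D : EtaSignedSelmerDualData V κ K₀ ℚ_[p] ηq γ 1),
        p ^ b ∣ Nat.card (IwasawaAlgebra.coinvariants p D.X ⧸
          (Submodule.torsion ℤ (IwasawaAlgebra.coinvariants p D.X) ⊔
            (LinearMap.range (IwasawaAlgebra.bockstein p D.X)).restrictScalars ℤ))) :
    QuadraticBranchPlusEtaLowerInclusionAt V p := by
  intro K₀ _ _ _ _ ηq hηK hη1 N _ f hp2 hgood' hap' hf ϖ hϖ Lη hL κ γ hκ hγ hγK hγc D
  obtain ⟨hfinD, htor⟩ :=
    EtaSignedSelmerDualData.finite_isTorsion_of_thm22 h22 hηK hp2 hgood' hap' hκ hγ hγK D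
  haveI : Module.Finite (IwasawaAlgebra p) D.X := hfinD
  obtain ⟨g, hg⟩ := (charIdeal_isPrincipal_holds p D.X).principal
  have hg' : D.charIdeal = Ideal.span {g} := hg
  -- Kato side: `g ∣ Lη`
  obtain ⟨-, hup⟩ := EtaSignedSelmerDualData.thm41_plus_of_facts h22 h41 hηK hη1 hp2 hgood' hap' hf
    ϖ hϖ Lη hL hκ hγ hγK hγc D
  have hgL : g ∣ Lη := by
    have h := hup hsurj
    rw [hg', Ideal.span_singleton_le_span_singleton] at h
    exact h
  have hanL := han hf ϖ hϖ Lη hL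
  have hne : PowerSeries.coeff (V.quadraticTwist ((-1) ^ (p / 2) * p)).mordellWeilRank Lη ≠ 0 :=
    fun h0 => hanL (by rw [h0]; exact dvd_zero _)
  -- rank bound, leading coefficient
  have hXg := X_pow_twistRank_dvd_etaCharGenerator_of_namedFacts_of_certV h12 h13 h22 hp5 hgood hap
    hsurj (fun f hf => hcertV f hf) hf K₀ ηq hηK hη1 κ γ hκ hγ hγK hγc D hg'
  obtain ⟨u, hu⟩ := coeff_twistRank_etaCharGenerator_eq_unit_mul_card_coker_bockstein h12 h13 h22 h41
    hKO hp5 hgood hap hsurj (fun f hf => hcertV f hf) hf ϖ hϖ Lη hL hne K₀ ηq hηK hη1 κ γ hκ hγ hγK hγc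
    D hg'
  -- the splitting `#coker φ = #tors · #heightIndex`
  have hsplit := natCard_coker_bockstein_eta_eq_torsion_mul_heightIndex h12 h13 h22 h41 hKO hp5 hgood
    hap hsurj (fun f hf => hcertV f hf) hf ϖ hϖ Lη hL hne K₀ ηq hηK hη1 κ γ hκ hγ hγK hγc D
  -- torsion part: `#(S^Γ/B) = #(D.X/T·D.X)_tors`
  obtain ⟨B, hdiv, hfin, hpB⟩ := hcot K₀ ηq hηK hη1 κ γ hκ hγ hγK hγc
  have hdual := EtaSignedSelmerDualData.isDualPair V κ K₀ ℚ_[p] ηq 1 D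
    (kappa_surjOn_galRange_cyclotomic κ K₀) hγ hγK
  obtain ⟨Ψ, -⟩ := hdual.exists_coinvariants_addEquiv
  have htorsEq : Nat.card (AddCommGroup.torsion (IwasawaAlgebra.coinvariants p D.X)) =
      Nat.card (IwasawaDual.endInvariants
        (conjTowerSignedSelmerInftyEta V κ K₀ ℚ_[p] ηq 1 γ - 1) ⧸ B) := by
    rw [natCard_torsion_congr Ψ, natCard_torsion_characterModule_eq_of_divisible B hdiv hfin]
  -- height index
  have hpb := hht K₀ ηq hηK hη1 κ γ hκ hγ hγK hγc D
  have hab : p ^ (a + b) ∣ Nat.card (IwasawaAlgebra.coinvariants p D.X ⧸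
      LinearMap.range (IwasawaAlgebra.bockstein p D.X)) := by
    rw [hsplit, htorsEq, pow_add]
    exact mul_dvd_mul hpB hpb
  have halg : (p : ℤ_[p]) ^ (a + b) ∣
      PowerSeries.coeff (V.quadraticTwist ((-1) ^ (p / 2) * p)).mordellWeilRank g := by
    rw [hu]
    obtain ⟨c, hc⟩ := hab
    refine Dvd.dvd.mul_left ?_ _
    rw [hc, Nat.cast_mul, Nat.cast_pow]
    exact dvd_mul_right _ _
  have heq : Ideal.span {g} = Ideal.span {Lη} :=
    span_singleton_eq_of_X_pow_dvd_of_dvd_of_pow_dvd_coeff hXg hgL halg hanL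
  rw [← heq, ← hg']

/-- **(E⁺_η) AT A TOWER-ONTO PAIR OF ANY RANK from `p^a ∣ #(X_η/TX_η)_tors` AND the HEIGHT INDEX**
(p505261's currency for the torsion part). Same as
`quadraticBranchPlusEtaLowerInclusionAt_of_namedFacts_of_certV_of_divisibleIndexDvd_of_heightIndexDvd` with the
torsion input stated directly on the `Γ`-coinvariants of every `η`-datum: `p^a ∣ #(D.X/T·D.X)_tors` and
`p^b ∣ #(D.X/T·D.X ⁄ (tors ⊔ φ(D.X[T])))`, analytic certificate `p^{a+b+1} ∤ coeff_r L_p⁺(V,η,T)`.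
CONDITIONAL; closes nothing. [cite: Kobayashi2003, Thm. 2.2 (p. 5), Thm. 4.1 and §4 (p. 8)]
[cite: KitajimaOtsuki2018, Thm. 1.3] [cite: CoatesSchneiderSujatha2003, §3 (30)–(31)] -/
theorem quadraticBranchPlusEtaLowerInclusionAt_of_namedFacts_of_certV_of_torsionDvd_of_heightIndexDvd
    (h12 : Kobayashi2003.thm12_signedSelmerDual_finite_torsion)
    (h13 : Kobayashi2003.thm41_signedCharIdeal_divisibility)
    (h22 : Kobayashi2003.thm22_etaSignedSelmerDual_finite_torsion)
    (h41 : Kobayashi2003.thm41_plusEtaCharIdeal_dvd)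
    (hKO : KitajimaOtsuki2018.mainThm13_etaSignedSelmerDual_noFiniteSubmodule)
    (hp5 : 5 ≤ p) (hgood : V.HasGoodReductionAtPrime p) (hap : V.frobeniusTrace p = 0)
    (hsurj : ∀ m : ℕ, V.HasSurjectiveModNGaloisRep (p ^ m : ℕ))
    (hcertV : ∀ {N : ℕ} [NeZero N] (f : CuspForm (Gamma0 N) 2), IsNewformOf V f →
      ∃ L : IwasawaAlgebra p, Kobayashi2003.IsSignedPAdicLFunction f p 1 L ∧
        IsUnit (PowerSeries.coeff V.mordellWeilRank L))
    (a b : ℕ)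
    (han : ∀ {N : ℕ} [NeZero N] {f : CuspForm (Gamma0 N) 2}, IsNewformOf V f →
      ∀ (ϖ : ℚ), (if Even (p / 2) then (ϖ : ℝ) * V.realPeriodRat = plusPeriod f
          else (ϖ : ℝ) * V.imaginaryPeriodRat = minusPeriod f) →
      ∀ (Lη : IwasawaAlgebra p), IsQuadraticBranchPlusLFunction f p ϖ Lη →
        ¬ (p : ℤ_[p]) ^ (a + b + 1) ∣
          PowerSeries.coeff (V.quadraticTwist ((-1) ^ (p / 2) * p)).mordellWeilRank Lη)
    (htors : ∀ (K₀ : Type) [Field K₀] [NumberField K₀] [IsCyclotomicExtension {p} ℚ K₀]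
      [(galRange (K := ℚ) K₀).Normal] (ηq : absoluteGaloisGroup ℚ →* ℤˣ),
      (∀ σ ∈ galRange (K := ℚ) K₀, ηq σ = 1) → ηq ≠ 1 →
      ∀ (κ : ZpExtension ℚ p) (γ : absoluteGaloisGroup ℚ),
        κ.IsCyclotomic → κ.IsTopGenerator γ → γ ∈ galRange (K := ℚ) K₀ → IsCyclotomicVariable p γ →
      ∀ {N : ℕ} [NeZero N] {f : CuspForm (Gamma0 N) 2}, IsNewformOf V f →
      ∀ (ϖ : ℚ), (if Even (p / 2) then (ϖ : ℝ) * V.realPeriodRat = plusPeriod f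
          else (ϖ : ℝ) * V.imaginaryPeriodRat = minusPeriod f) →
      ∀ (Lη : IwasawaAlgebra p), IsQuadraticBranchPlusLFunction f p ϖ Lη →
        PowerSeries.coeff (V.quadraticTwist ((-1) ^ (p / 2) * p)).mordellWeilRank Lη ≠ 0 →
      ∀ (D : EtaSignedSelmerDualData V κ K₀ ℚ_[p] ηq γ 1),
        p ^ a ∣ Nat.card (AddCommGroup.torsion (IwasawaAlgebra.coinvariants p D.X)))
    (hht : ∀ (K₀ : Type) [Field K₀] [NumberField K₀] [IsCyclotomicExtension {p} ℚ K₀]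
      [(galRange (K := ℚ) K₀).Normal] (ηq : absoluteGaloisGroup ℚ →* ℤˣ),
      (∀ σ ∈ galRange (K := ℚ) K₀, ηq σ = 1) → ηq ≠ 1 →
      ∀ (κ : ZpExtension ℚ p) (γ : absoluteGaloisGroup ℚ),
        κ.IsCyclotomic → κ.IsTopGenerator γ → γ ∈ galRange (K := ℚ) K₀ → IsCyclotomicVariable p γ →
      ∀ (D : EtaSignedSelmerDualData V κ K₀ ℚ_[p] ηq γ 1),
        p ^ b ∣ Nat.card (IwasawaAlgebra.coinvariants p D.X ⧸
          (Submodule.torsion ℤ (IwasawaAlgebra.coinvariants p D.X) ⊔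
            (LinearMap.range (IwasawaAlgebra.bockstein p D.X)).restrictScalars ℤ))) :
    QuadraticBranchPlusEtaLowerInclusionAt V p := by
  intro K₀ _ _ _ _ ηq hηK hη1 N _ f hp2 hgood' hap' hf ϖ hϖ Lη hL κ γ hκ hγ hγK hγc D
  obtain ⟨hfinD, htor⟩ :=
    EtaSignedSelmerDualData.finite_isTorsion_of_thm22 h22 hηK hp2 hgood' hap' hκ hγ hγK D
  haveI : Module.Finite (IwasawaAlgebra p) D.X := hfinD
  obtain ⟨g, hg⟩ := (charIdeal_isPrincipal_holds p D.X).principal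
  have hg' : D.charIdeal = Ideal.span {g} := hg
  obtain ⟨-, hup⟩ := EtaSignedSelmerDualData.thm41_plus_of_facts h22 h41 hηK hη1 hp2 hgood' hap' hf
    ϖ hϖ Lη hL hκ hγ hγK hγc D
  have hgL : g ∣ Lη := by
    have h := hup hsurj
    rw [hg', Ideal.span_singleton_le_span_singleton] at h
    exact h
  have hanL := han hf ϖ hϖ Lη hL
  have hne : PowerSeries.coeff (V.quadraticTwist ((-1) ^ (p / 2) * p)).mordellWeilRank Lη ≠ 0 :=
    fun h0 => hanL (by rw [h0]; exact dvd_zero _)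
  have hXg := X_pow_twistRank_dvd_etaCharGenerator_of_namedFacts_of_certV h12 h13 h22 hp5 hgood hap
    hsurj (fun f hf => hcertV f hf) hf K₀ ηq hηK hη1 κ γ hκ hγ hγK hγc D hg'
  obtain ⟨u, hu⟩ := coeff_twistRank_etaCharGenerator_eq_unit_mul_card_coker_bockstein h12 h13 h22 h41
    hKO hp5 hgood hap hsurj (fun f hf => hcertV f hf) hf ϖ hϖ Lη hL hne K₀ ηq hηK hη1 κ γ hκ hγ hγK hγc
    D hg'
  have hsplit := natCard_coker_bockstein_eta_eq_torsion_mul_heightIndex h12 h13 h22 h41 hKO hp5 hgood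
    hap hsurj (fun f hf => hcertV f hf) hf ϖ hϖ Lη hL hne K₀ ηq hηK hη1 κ γ hκ hγ hγK hγc D
  have hpa := htors K₀ ηq hηK hη1 κ γ hκ hγ hγK hγc hf ϖ hϖ Lη hL hne D
  have hpb := hht K₀ ηq hηK hη1 κ γ hκ hγ hγK hγc D
  have hab : p ^ (a + b) ∣ Nat.card (IwasawaAlgebra.coinvariants p D.X ⧸
      LinearMap.range (IwasawaAlgebra.bockstein p D.X)) := by
    rw [hsplit, pow_add]
    exact mul_dvd_mul hpa hpb
  have halg : (p : ℤ_[p]) ^ (a + b) ∣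
      PowerSeries.coeff (V.quadraticTwist ((-1) ^ (p / 2) * p)).mordellWeilRank g := by
    rw [hu]
    obtain ⟨c, hc⟩ := hab
    refine Dvd.dvd.mul_left ?_ _
    rw [hc, Nat.cast_mul, Nat.cast_pow]
    exact dvd_mul_right _ _
  have heq : Ideal.span {g} = Ideal.span {Lη} :=
    span_singleton_eq_of_X_pow_dvd_of_dvd_of_pow_dvd_coeff hXg hgL halg hanL
  rw [← heq, ← hg']

end Pair

end Summit.BirchSwinnertonDyer.BirchSwinnertonDyer.Theorems

end
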